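import Mathlib
import Literature.NumberTheory.Transcendental.NormDescentAlongSequence
import Literature.NumberTheory.DiophantineGeometry.AbcWave0RothProofs
import Summits.Schanuel.Schanuel.Theses.RigidCore

/-!
# Linear torsion cusps of depth `> e` carry finitely many hits (stub `stub_rothCuspFinite`)

Stub (pocket "depth `> e`") of the line `cusp-germ-schneider-sparsity` for the crux
`RigidCore.SparsityTwo` (item stmt-Schanuel-0971). In the algebraic uniformiser `t` of a LINEAR
TORSION HOMOGENEOUS cusp of a `ℚ`-curve the hits `n` satisfy `(t n)⁻ᵉ = 2πi n + c n` with `c n`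
convergent, and the hit condition reads `β (q n + m₁) + q Φ(t n)/(2πi) ∈ ℤ`, where `β` is the real
algebraic slope and `Φ` the defect germ (analytic at `0`, `Φ 0 = 0`, `Φ ≢ 0` near `0`). If `Φ`
vanishes to order `> e` at `0` there are only finitely many hits:

* `β ∈ ℚ`: the integers `den(β) · q Φ(t n)/(2πi)` tend to `0`, hence vanish at all large hits, so
  `Φ` vanishes at points accumulating at `0` — identity theorem
  (`eventually_zero_of_infinite_ratSlope_hits`);
* `β ∉ ℚ`: Taylor's formula `Φ z = z^{e+1} F z` (`F` analytic at `0`) gives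
  `‖Φ (t n)‖ ≤ K ‖t n‖^{e+1}`, while `‖t n‖^e = 1/‖2πi n + c n‖ ≤ 1/n`; with `M = q n + m₁ ≍ n` a
  hit `L` is a rational approximation `|β - L/M| = ‖q Φ(t n)/(2π i)‖ / M ≪ M^{-2-1/e}`, and for
  large `M` this contradicts ROTH'S THEOREM with exponent `p = 2 + 1/(2e)`
  (`Literature.NumberTheory.DiophantineGeometry.roth_holds`, PROVED in the tree: a real irrational
  algebraic number is not `LiouvilleWith p` for any `p > 2`).

Sources: Mathlib (`AnalyticAt.exists_eq_sum_add_pow_mul`, `LiouvilleWith`, `Irrational`, the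
`Real.rpow` API), the Literature files `NormDescentAlongSequence` (identity-theorem branch) and
`AbcWave0RothProofs` (Roth's theorem, Schmidt LNM 785 Ch. V). No unproved facts.
-/

set_option linter.dupNamespace false

namespace Summit.Schanuel.Schanuel.Cruxes.SparsityTwo.CuspGermSchneiderSparsity

open Filter Topology Complex Polynomial Literature.NumberTheory.Transcendental
open scoped Real

/-- Roth's theorem unfolded (constant `C = 1`): for a real irrational algebraic `x` and `p > 2`,
beyond some denominator `N` every rational `m / n ≠ x` satisfies `|x − m/n| ≥ n^(−p)`
(tree theorem `Literature.NumberTheory.DiophantineGeometry.roth_holds`). -/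
theorem rothCuspFinite_approx {x : ℝ} (halg : IsAlgebraic ℚ x) (hirr : Irrational x) {p : ℝ}
    (hp : 2 < p) :
    ∃ N : ℕ, ∀ n : ℕ, N ≤ n → ∀ m : ℤ, x ≠ m / n → 1 / (n : ℝ) ^ p ≤ |x - m / n| := by
  have h : ¬ LiouvilleWith p x :=
    Literature.NumberTheory.DiophantineGeometry.roth_holds halg hirr hp
  simp only [LiouvilleWith, not_exists, Filter.not_frequently, not_and, not_lt,
    Filter.eventually_atTop] at h
  exact h 1

/-- The final bookkeeping of the Roth branch, in natural powers only: the Roth lower bound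
`1 ≤ K s^{e+1} μ ν` (`ν^{2e} = μ`, i.e. `ν = μ^{1/(2e)}`), the cusp scale `n s^e ≤ 1` and the
denominator size `μ ≤ B n` are incompatible once `n > K^{2e} B^{2e+1}`. -/
theorem rothCuspFinite_arith {e : ℕ} {K s μ ν B n : ℝ} (hK : 0 ≤ K) (hs : 0 ≤ s) (hμ : 0 ≤ μ)
    (hn : 0 < n) (hX : 1 ≤ K * s ^ (e + 1) * μ * ν) (hsn : n * s ^ e ≤ 1) (hμB : μ ≤ B * n)
    (hνμ : ν ^ (2 * e) = μ) (hbig : K ^ (2 * e) * B ^ (2 * e + 1) < n) : False := by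
  have h1 : (1 : ℝ) ≤ (K * s ^ (e + 1) * μ * ν) ^ (2 * e) := one_le_pow₀ hX
  have h3 : (n * s ^ e) ^ (2 * e + 2) ≤ 1 := pow_le_one₀ (by positivity) hsn
  have h4 : μ ^ (2 * e + 1) ≤ (B * n) ^ (2 * e + 1) := pow_le_pow_left₀ hμ hμB _
  have h5 : n ^ (2 * e + 2) ≤ K ^ (2 * e) * B ^ (2 * e + 1) * n ^ (2 * e + 1) := by
    calc n ^ (2 * e + 2) ≤ n ^ (2 * e + 2) * (K * s ^ (e + 1) * μ * ν) ^ (2 * e) :=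
          le_mul_of_one_le_right (by positivity) h1
      _ = K ^ (2 * e) * (n * s ^ e) ^ (2 * e + 2) * (μ ^ (2 * e) * ν ^ (2 * e)) := by ring
      _ = K ^ (2 * e) * (n * s ^ e) ^ (2 * e + 2) * μ ^ (2 * e + 1) := by rw [hνμ, ← pow_succ]
      _ ≤ K ^ (2 * e) * 1 * (B * n) ^ (2 * e + 1) :=
          mul_le_mul (mul_le_mul_of_nonneg_left h3 (by positivity)) h4 (by positivity)
            (by positivity)
      _ = K ^ (2 * e) * B ^ (2 * e + 1) * n ^ (2 * e + 1) := by ring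
  have h6 : n * n ^ (2 * e + 1) ≤ K ^ (2 * e) * B ^ (2 * e + 1) * n ^ (2 * e + 1) := by
    calc n * n ^ (2 * e + 1) = n ^ (2 * e + 2) := by ring
      _ ≤ _ := h5
  have h7 : n ≤ K ^ (2 * e) * B ^ (2 * e + 1) := le_of_mul_le_mul_right h6 (by positivity)
  linarith

/-- **stub_rothCuspFinite** (POCKET "depth `> e`" of the linear torsion homogeneous cusp).
With `M n = q n + m₁`, `r n = q Φ(t n)/(2πi)`, a hit is `β M n + r n ∈ ℤ`.
`β ∈ ℚ`: the integers `den(β) r n → 0` vanish at large hits, identity theorem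
(`eventually_zero_of_infinite_ratSlope_hits`). `β ∉ ℚ`: Taylor `Φ z = z^{e+1} F z` (the
derivatives of order `≤ e` vanish), `‖t n‖^e = 1/‖2πi n + c n‖ ≤ 1/n`, `M n ≤ (q + |m₁|) n`, so a
hit `L` gives `|β - L/(M n)| = ‖r n‖/(M n) ≪ (M n)^{-2-1/e}`; Roth's theorem (`roth_holds`) with
exponent `2 + 1/(2e)` excludes this for all large `n`, so the hit set is finite. -/
theorem stub_rothCuspFinite :
    ∀ (e q : ℕ) (m₁ : ℤ) (β : ℂ) (Φ : ℂ → ℂ) (t c : ℕ → ℂ) (lam : ℂ),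
      0 < e → 0 < q → β.im = 0 → IsAlgebraic ℚ β →
      AnalyticAt ℂ Φ 0 → Φ 0 = 0 → (¬ ∀ᶠ z in 𝓝 (0 : ℂ), Φ z = 0) →
      (∀ j : ℕ, j ≤ e → iteratedDeriv j Φ 0 = 0) →
      Tendsto t atTop (𝓝 0) → Tendsto c atTop (𝓝 lam) →
      (∀ᶠ n : ℕ in atTop, t n ≠ 0 ∧ ((t n) ^ e)⁻¹ = 2 * ↑π * I * (n : ℂ) + c n) →
      Set.Finite {n : ℕ | ∃ L : ℤ,
        β * ((q : ℂ) * (n : ℂ) + (m₁ : ℂ)) + (q : ℂ) * Φ (t n) / (2 * ↑π * I) = L} := by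
  intro e q m₁ β Φ t c lam he hq hβim hβalg hΦan hΦ0 hΦne hvan ht hc hrel
  -- `β = x` is real
  obtain ⟨x, rfl⟩ : ∃ x : ℝ, (x : ℂ) = β := ⟨β.re, Complex.ext (by simp) (by simp [hβim])⟩
  have hxalg : IsAlgebraic ℚ x := by
    rw [← isAlgebraic_algebraMap_iff (R := ℚ) (A := ℂ) (algebraMap ℝ ℂ).injective,
      Complex.coe_algebraMap]
    exact hβalg
  -- common data
  have h2pi : (2 * (π : ℂ) * I) ≠ 0 := by simp [Real.pi_ne_zero, I_ne_zero]
  have hqC : (q : ℂ) ≠ 0 := Nat.cast_ne_zero.mpr hq.ne'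
  have htne : Tendsto t atTop (𝓝[≠] 0) :=
    tendsto_nhdsWithin_iff.mpr ⟨ht, hrel.mono fun n hn => hn.1⟩
  set M : ℕ → ℤ := fun n => (q : ℤ) * n + m₁ with hM_def
  have hMC : ∀ n : ℕ, ((M n : ℤ) : ℂ) = (q : ℂ) * (n : ℂ) + (m₁ : ℂ) := fun n => by
    simp [hM_def]
  by_cases hirr : Irrational x
  swap
  · -- RATIONAL slope: identity theorem
    obtain ⟨b₀, hb₀⟩ : ∃ b₀ : ℚ, (b₀ : ℝ) = x := by simpa [Irrational] using hirr
    have hxb : ((x : ℝ) : ℂ) = ((b₀ : ℚ) : ℂ) := by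
      rw [← hb₀, Complex.ofReal_ratCast]
    by_contra hinf
    apply hΦne
    have hg : AnalyticAt ℂ (fun z => (q : ℂ) * Φ z / (2 * π * I)) 0 :=
      (analyticAt_const.mul hΦan).div analyticAt_const h2pi
    have hg0 : (fun z => (q : ℂ) * Φ z / (2 * π * I)) 0 = 0 := by simp [hΦ0]
    have hinf' : Set.Infinite {n : ℕ | ∃ L : ℤ,
        ((b₀ : ℚ) : ℂ) * (M n : ℂ) + (fun z => (q : ℂ) * Φ z / (2 * π * I)) (t n) = L} := by
      refine (Set.not_finite.mp hinf).mono ?_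
      rintro n ⟨L, hL⟩
      refine ⟨L, ?_⟩
      rw [hMC, ← hxb]
      dsimp only
      linear_combination hL
    have hev := eventually_zero_of_infinite_ratSlope_hits hg hg0 htne hinf'
    filter_upwards [hev] with z hz
    rw [div_eq_zero_iff, mul_eq_zero] at hz
    rcases hz with (h | h) | h
    · exact absurd h hqC
    · exact h
    · exact absurd h h2pi
  · -- IRRATIONAL slope: Roth's theorem with exponent `p = 2 + 1/(2e)`
    have he0 : (0 : ℝ) < e := Nat.cast_pos.mpr he
    obtain ⟨p, hp⟩ : ∃ p : ℝ, p = 2 + 1 / (2 * (e : ℝ)) := ⟨_, rfl⟩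
    have hp2 : (2 : ℝ) < p := by
      have : (0 : ℝ) < 1 / (2 * (e : ℝ)) := by positivity
      linarith
    obtain ⟨N, hN⟩ := rothCuspFinite_approx hxalg hirr hp2
    -- Taylor: `Φ z = z^(e+1) F z`
    obtain ⟨F, hF, hΦeq⟩ := hΦan.exists_eq_sum_add_pow_mul (e + 1)
    have hΦeq' : ∀ z, Φ z = z ^ (e + 1) * F z := by
      intro z
      rw [hΦeq z, Finset.sum_eq_zero (fun i hi => ?_), zero_add, smul_eq_mul]
      rw [Finset.mem_range] at hi
      rw [hvan i (by omega), smul_zero]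
    have hFt : Tendsto (fun n => F (t n)) atTop (𝓝 (F 0)) := hF.continuousAt.tendsto.comp ht
    have hFb : ∀ᶠ n in atTop, ‖F (t n)‖ ≤ ‖F 0‖ + 1 :=
      hFt.norm.eventually (eventually_le_nhds (lt_add_one _))
    have hcb : ∀ᶠ n in atTop, ‖c n‖ ≤ ‖lam‖ + 1 :=
      hc.norm.eventually (eventually_le_nhds (lt_add_one _))
    -- `M n → +∞`
    have hMtop : Tendsto M atTop atTop := by
      refine tendsto_atTop_mono (fun n => ?_)
        (tendsto_atTop_add_const_right atTop m₁ tendsto_natCast_atTop_atTop)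
      have h1 : (1 : ℤ) ≤ q := by exact_mod_cast hq
      simp only [hM_def]
      nlinarith [Int.natCast_nonneg n]
    -- the two constants of the final comparison
    obtain ⟨K, hK⟩ : ∃ K : ℝ, K = (q : ℝ) * (‖F 0‖ + 1) := ⟨_, rfl⟩
    obtain ⟨B, hB⟩ : ∃ B : ℝ, B = (q : ℝ) + |(m₁ : ℝ)| := ⟨_, rfl⟩
    have hK0 : 0 ≤ K := by rw [hK]; positivity
    have h2piI : ‖(2 * (π : ℂ) * I)‖ = 2 * π := by
      rw [norm_mul, norm_mul, Complex.norm_I, mul_one, Complex.norm_real, Complex.norm_ofNat,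
        Real.norm_eq_abs, abs_of_pos Real.pi_pos]
    -- eventually there is no hit
    have key : ∀ᶠ n : ℕ in atTop, ¬ ∃ L : ℤ,
        ((x : ℝ) : ℂ) * ((q : ℂ) * (n : ℂ) + (m₁ : ℂ)) + (q : ℂ) * Φ (t n) / (2 * ↑π * I) = L := by
      filter_upwards [hrel, hFb, hcb,
        (tendsto_natCast_atTop_atTop (R := ℝ)).eventually_ge_atTop (‖lam‖ + 1),
        hMtop.eventually_ge_atTop (N : ℤ), hMtop.eventually_ge_atTop 1,
        (tendsto_natCast_atTop_atTop (R := ℝ)).eventually_gt_atTop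
          (K ^ (2 * e) * B ^ (2 * e + 1)),
        eventually_ge_atTop 1] with n hn hFn hcn hnlam hMN hM1 hnbig hn1
      rintro ⟨L, hL⟩
      -- the denominator `m = M n ≥ 1`
      obtain ⟨m, hm⟩ : ∃ m : ℕ, M n = m := Int.eq_ofNat_of_zero_le (by omega)
      have hNm : N ≤ m := by omega
      have hm1 : 1 ≤ m := by omega
      have hμ1 : (1 : ℝ) ≤ m := by exact_mod_cast hm1
      have hμpos : (0 : ℝ) < m := by linarith
      have hn1' : (1 : ℝ) ≤ n := by exact_mod_cast hn1
      have hμq : (m : ℝ) = (q : ℝ) * n + m₁ := by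
        have h1 : ((M n : ℤ) : ℝ) = (m : ℝ) := by rw [hm]; simp
        rw [← h1]
        simp [hM_def]
      have hμB : (m : ℝ) ≤ B * n := by
        rw [hμq, hB]
        nlinarith [le_abs_self (m₁ : ℝ), abs_nonneg (m₁ : ℝ)]
      -- the hit value `q Φ(t n)/(2πi) = L - x m` is real
      have hmC : ((m : ℕ) : ℂ) = (q : ℂ) * n + m₁ := by
        rw [← hMC n, hm]
        simp
      have hρC : (((L : ℝ) - x * m : ℝ) : ℂ) = (q : ℂ) * Φ (t n) / (2 * π * I) := by
        push_cast
        rw [hmC]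
        linear_combination -hL
      -- Roth's inequality at `L / m`
      have hne : x ≠ (L : ℝ) / (m : ℝ) := by
        have h1 := hirr.ne_rational L m
        rwa [Int.cast_natCast] at h1
      have hroth : 1 / (m : ℝ) ^ p ≤ |x - L / m| := hN m hNm L hne
      have habs : |x - L / m| = |(L : ℝ) - x * m| / m := by
        have h1 : x - L / m = -((L : ℝ) - x * m) / m := by
          field_simp
          ring
        rw [h1, abs_div, abs_neg, abs_of_pos hμpos]
      obtain ⟨ν, hν⟩ : ∃ ν : ℝ, (m : ℝ) ^ (1 / (2 * (e : ℝ))) = ν := ⟨_, rfl⟩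
      have hνpos : 0 < ν := by rw [← hν]; exact Real.rpow_pos_of_pos hμpos _
      have hμp : (m : ℝ) ^ p = (m : ℝ) ^ 2 * ν := by
        rw [hp, Real.rpow_add hμpos, Real.rpow_two, hν]
      have hνμ : ν ^ (2 * e) = (m : ℝ) := by
        rw [← hν, ← Real.rpow_natCast, ← Real.rpow_mul hμpos.le]
        have h1 : 1 / (2 * (e : ℝ)) * ((2 * e : ℕ) : ℝ) = 1 := by
          push_cast
          field_simp
        rw [h1, Real.rpow_one]
      have hX1 : 1 ≤ |(L : ℝ) - x * m| * m * ν := by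
        rw [habs, hμp, div_le_div_iff₀ (by positivity) hμpos] at hroth
        refine le_of_mul_le_mul_left ?_ hμpos
        calc (m : ℝ) * 1 = 1 * m := by ring
          _ ≤ |(L : ℝ) - x * m| * ((m : ℝ) ^ 2 * ν) := hroth
          _ = (m : ℝ) * (|(L : ℝ) - x * m| * m * ν) := by ring
      -- size of the hit value: `|L - x m| ≤ K ‖t n‖^(e+1)`
      have hs : 0 < ‖t n‖ := norm_pos_iff.mpr hn.1
      have hρle : |(L : ℝ) - x * m| ≤ K * ‖t n‖ ^ (e + 1) := by
        have h1 : |(L : ℝ) - x * m| = ‖(q : ℂ) * Φ (t n) / (2 * π * I)‖ := by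
          rw [← hρC, Complex.norm_real, Real.norm_eq_abs]
        rw [h1, norm_div, h2piI, norm_mul, Complex.norm_natCast, hΦeq' (t n), norm_mul,
          norm_pow, hK]
        calc (q : ℝ) * (‖t n‖ ^ (e + 1) * ‖F (t n)‖) / (2 * π)
            ≤ (q : ℝ) * (‖t n‖ ^ (e + 1) * ‖F (t n)‖) :=
              div_le_self (by positivity) (by linarith [Real.pi_gt_three])
          _ ≤ (q : ℝ) * (‖t n‖ ^ (e + 1) * (‖F 0‖ + 1)) := by gcongr
          _ = (q : ℝ) * (‖F 0‖ + 1) * ‖t n‖ ^ (e + 1) := by ring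
      have hX : 1 ≤ K * ‖t n‖ ^ (e + 1) * m * ν := by
        calc (1 : ℝ) ≤ |(L : ℝ) - x * m| * m * ν := hX1
          _ ≤ K * ‖t n‖ ^ (e + 1) * m * ν := by gcongr
      -- the cusp scale: `n ‖t n‖^e ≤ 1`
      have hsn : (n : ℝ) * ‖t n‖ ^ e ≤ 1 := by
        have hnorm : ‖2 * (π : ℂ) * I * (n : ℂ) + c n‖ = (‖t n‖ ^ e)⁻¹ := by
          rw [← hn.2, norm_inv, norm_pow]
        have htri := norm_le_add_norm_add (2 * (π : ℂ) * I * (n : ℂ)) (c n)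
        have h2pin : ‖2 * (π : ℂ) * I * (n : ℂ)‖ = 2 * π * n := by
          rw [norm_mul, h2piI, Complex.norm_natCast]
        rw [hnorm, h2pin] at htri
        have hπn : (3 : ℝ) * n ≤ π * n :=
          mul_le_mul_of_nonneg_right Real.pi_gt_three.le (Nat.cast_nonneg n)
        have hle : (n : ℝ) ≤ (‖t n‖ ^ e)⁻¹ := by linarith
        rw [inv_eq_one_div, le_div_iff₀ (pow_pos hs e)] at hle
        exact hle
      exact rothCuspFinite_arith hK0 hs.le hμpos.le (by positivity) hX hsn hμB hνμ hnbig
    obtain ⟨N₀, hN₀⟩ := eventually_atTop.mp key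
    refine (Set.finite_lt_nat N₀).subset fun n hn => ?_
    exact not_le.mp fun h => hN₀ n h hn

end Summit.Schanuel.Schanuel.Cruxes.SparsityTwo.CuspGermSchneiderSparsity
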